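import Literature.MathematicalPhysics.QuantumLattice.JordanWignerEmbedding
import HarnessLib

/-!
# Jordan–Wigner versus isotony, II(a): strings below a final segment

Topic `MathematicalPhysics/QuantumLattice`; namespace `Literature.MathematicalPhysics.QuantumLattice.JordanWigner`.
Sequel of `JordanWignerEmbedding.lean`. Everything here is a PROVED theorem; no definition, no named fact.

For an order embedding `φ : Λ₁ ↪o Λ₂` whose image is an UPPER set (a final segment) the Jordan–Wigner string of an image
site runs through all the sites BELOW the block: `jwString (φ x) = P_below · Γ^{spin}_φ (jwString x)` with
`P_below = ⨂_{z ∉ im φ} F_z` (`jwString_eq_of_isUpperSet`; Essler et al. §12.3.4 (12.198)–(12.201): the factors `σ^z ⊗ σ^z`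
on one side of site `j`). This file collects the bookkeeping used by the sequel `JordanWignerEmbeddingUpper.lean`:
`P_below` is a diagonal involution commuting with the image `Γ^{spin}_φ(Op Λ₁ 4)` of the block
(`productOp_below_mul_spinEmbed_comm`, graded locality in the sense of Araki–Moriya §4.1) and with the block parity
`Q = Γ^{spin}_φ(⨂F)` (`spinEmbed_productOp_siteParity`, `spinEmbed_toSpin_parityAut`).

## References

* F. H. L. Essler et al., *The One-Dimensional Hubbard Model*, CUP (2005), §12.3.4 eqs. (12.196)–(12.201).
  [cite: EsslerEtAl2005, §12.3.4 eqs. (12.196)–(12.201)]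
* H. Araki, H. Moriya, Rev. Math. Phys. 15 (2003) 93, §4.1 (Θ-grading, graded locality). [cite: ArakiMoriya2003, §4.1 Def. 4.1–4.3]
* O. Bratteli, D. W. Robinson, *OAQSM 2*, 2nd ed., §5.2.2 Thm. 5.2.5, §6.2.1. [cite: BratteliRobinsonII1997, §5.2.2 Thm. 5.2.5]
-/

noncomputable section

namespace Literature.MathematicalPhysics.QuantumLattice

open Matrix Finset HubbardWave0

namespace JordanWigner


/-! ### Upper sets: the strings below the block -/

section UpperSet

variable {Λ₁ Λ₂ : Type*} [LinearOrder Λ₁] [Fintype Λ₁] [LinearOrder Λ₂] [Fintype Λ₂]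

omit [Fintype Λ₁] [Fintype Λ₂] in
/-- Below a final segment: a site outside an upper-set image lies below every image site. [folklore] -/
private theorem lt_apply_of_not_mem_of_isUpperSet (φ : Λ₁ ↪o Λ₂) (hφ : IsUpperSet (Set.range φ)) {z : Λ₂}
    (hz : z ∉ Set.range φ) (x : Λ₁) : z < φ x := by
  by_contra h
  exact hz (hφ (not_lt.mp h) ⟨x, rfl⟩)

/-- **The string of an image site, final-segment case**: `jwString (φ x) = P_below · Γ_φ (jwString x)` with
`P_below = ⨂_{z ∉ im φ} F_z`. [cite: EsslerEtAl2005, §12.3.4 eqs. (12.198)–(12.201)] -/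
theorem jwString_eq_of_isUpperSet (φ : Λ₁ ↪o Λ₂) (hφ : IsUpperSet (Set.range φ)) (x : Λ₁) :
    jwString (φ.toEmbedding x) =
      productOp (fun z : Λ₂ => if z ∈ rangeSites φ.toEmbedding then (1 : Matrix (Fin 4) (Fin 4) ℂ) else siteParity) *
        spinEmbed φ.toEmbedding (jwString x) := by
  set v : Λ₂ → Matrix (Fin 4) (Fin 4) ℂ :=
    fun z => if z ∈ rangeSites φ.toEmbedding ∧ z < φ.toEmbedding x then siteParity else 1 with hvdef
  have hv : ∀ z, z ∉ Set.range φ.toEmbedding → v z = 1 := by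
    intro z hz
    have hz' : ¬ (z ∈ rangeSites φ.toEmbedding ∧ z < φ.toEmbedding x) := fun h => hz ((mem_rangeSites_iff _ _).1 h.1)
    simp only [hvdef, hz', if_false]
  have hmem : ∀ y : Λ₁, φ.toEmbedding y ∈ rangeSites φ.toEmbedding :=
    fun y => (mem_rangeSites_iff _ _).2 ⟨y, rfl⟩
  have hfam : (fun y : Λ₁ => if y < x then siteParity else (1 : Matrix (Fin 4) (Fin 4) ℂ)) =
      fun y => v (φ.toEmbedding y) := by
    funext y
    have hy := hmem y
    change (if y < x then siteParity else (1 : Matrix (Fin 4) (Fin 4) ℂ)) =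
      if φ.toEmbedding y ∈ rangeSites φ.toEmbedding ∧ φ y < φ x then siteParity else 1
    simp only [hy, true_and, OrderEmbedding.lt_iff_lt]
  have hsp : spinEmbed φ.toEmbedding (jwString x) = productOp v := by
    rw [jwString, hfam]
    exact spinEmbed_productOp φ.toEmbedding v hv
  rw [hsp, productOp_mul, jwString]
  congr 1
  funext z
  by_cases hz : z ∈ rangeSites φ.toEmbedding
  · simp only [hvdef, hz, if_true, true_and, one_mul]
  · have hz' : z ∉ Set.range φ := fun h => hz ((mem_rangeSites_iff _ _).2 h)
    have hlt : z < φ.toEmbedding x := lt_apply_of_not_mem_of_isUpperSet φ hφ hz' x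
    simp only [hvdef, hz, if_false, hlt, if_true, false_and, mul_one]

/-- `P_below` is diagonal, with a diagonal depending only on the configuration off the image.
[cite: EsslerEtAl2005, §12.3.4 eq. (12.198)] -/
theorem productOp_below_eq_diagonal (φ : Λ₁ ↪o Λ₂) :
    productOp (fun z : Λ₂ => if z ∈ rangeSites φ.toEmbedding then (1 : Matrix (Fin 4) (Fin 4) ℂ) else siteParity) =
      diagonal fun k : TensorIndex Λ₂ 4 =>
        ∏ z, (if z ∈ rangeSites φ.toEmbedding then (1 : ℂ) else (-1 : ℂ) ^ siteCharge (k z)) := by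
  have h1 : (fun z : Λ₂ => if z ∈ rangeSites φ.toEmbedding then (1 : Matrix (Fin 4) (Fin 4) ℂ) else siteParity) =
      fun z => diagonal fun a : Fin 4 =>
        if z ∈ rangeSites φ.toEmbedding then (1 : ℂ) else (-1 : ℂ) ^ siteCharge a := by
    funext z
    by_cases hz : z ∈ rangeSites φ.toEmbedding
    · simp only [hz, if_true]
      exact diagonal_one.symm
    · simp only [hz, if_false]
      rfl
  rw [h1, productOp_diagonal]

/-- **Diagonal operators that see only the sites off the image commute with every `Γ_φ S`.**
[cite: BratteliRobinsonII1997, §6.2.1] -/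
theorem diagonal_mul_spinEmbed_comm {q : ℕ} (φ : Λ₁ ↪ Λ₂) (d : TensorIndex Λ₂ q → ℂ)
    (hd : ∀ σ τ : TensorIndex Λ₂ q, (∀ y, y ∉ Set.range φ → σ y = τ y) → d σ = d τ) (S : Op Λ₁ q) :
    diagonal d * spinEmbed φ S = spinEmbed φ S * diagonal d := by
  ext σ τ
  rw [diagonal_mul, mul_diagonal, spinEmbed_apply]
  by_cases h : ∀ y, y ∉ Set.range φ → σ y = τ y
  · rw [if_pos h, hd σ τ h, mul_comm]
  · rw [if_neg h, mul_zero, zero_mul]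

/-- **`P_below` commutes with the image of the block.** [cite: ArakiMoriya2003, §4.1 Def. 4.1–4.3] -/
theorem productOp_below_mul_spinEmbed_comm (φ : Λ₁ ↪o Λ₂) (S : Op Λ₁ 4) :
    productOp (fun z : Λ₂ => if z ∈ rangeSites φ.toEmbedding then (1 : Matrix (Fin 4) (Fin 4) ℂ) else siteParity) *
        spinEmbed φ.toEmbedding S =
      spinEmbed φ.toEmbedding S *
        productOp (fun z : Λ₂ => if z ∈ rangeSites φ.toEmbedding then (1 : Matrix (Fin 4) (Fin 4) ℂ) else siteParity) := by
  rw [productOp_below_eq_diagonal]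
  refine diagonal_mul_spinEmbed_comm φ.toEmbedding _ (fun σ τ hστ => ?_) S
  refine Finset.prod_congr rfl fun z _ => ?_
  by_cases hz : z ∈ rangeSites φ.toEmbedding
  · simp only [hz, if_true]
  · have hz' : z ∉ Set.range φ.toEmbedding := fun h => hz ((mem_rangeSites_iff _ _).2 h)
    simp only [hz, if_false, hστ z hz']

/-- `P_below² = 1`. [cite: EsslerEtAl2005, §12.3.4 eq. (12.198)] -/
theorem productOp_below_mul_self (φ : Λ₁ ↪o Λ₂) :
    productOp (fun z : Λ₂ => if z ∈ rangeSites φ.toEmbedding then (1 : Matrix (Fin 4) (Fin 4) ℂ) else siteParity) *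
        productOp (fun z : Λ₂ => if z ∈ rangeSites φ.toEmbedding then (1 : Matrix (Fin 4) (Fin 4) ℂ) else siteParity) =
      1 := by
  rw [productOp_mul, ← productOp_one]
  congr 1
  funext z
  by_cases hz : z ∈ rangeSites φ.toEmbedding
  · simp only [hz, if_true, mul_one]
  · simp only [hz, if_false, siteParity_mul_siteParity]

/-- **The image of the block parity**: `Γ_φ (⨂_{Λ₁} F) = ⨂_{z ∈ im φ} F_z`. [cite: EsslerEtAl2005, §12.3.4 eq. (12.198)] -/
theorem spinEmbed_productOp_siteParity (φ : Λ₁ ↪o Λ₂) :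
    spinEmbed φ.toEmbedding (productOp fun _ : Λ₁ => siteParity) =
      productOp (fun z : Λ₂ => if z ∈ rangeSites φ.toEmbedding then siteParity else (1 : Matrix (Fin 4) (Fin 4) ℂ)) := by
  have hmem : ∀ y : Λ₁, φ.toEmbedding y ∈ rangeSites φ.toEmbedding :=
    fun y => (mem_rangeSites_iff _ _).2 ⟨y, rfl⟩
  have hfam : (fun _ : Λ₁ => siteParity) =
      fun y => (fun z : Λ₂ => if z ∈ rangeSites φ.toEmbedding then siteParity else (1 : Matrix (Fin 4) (Fin 4) ℂ))
        (φ.toEmbedding y) := by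
    funext y
    simp only [hmem y, if_true]
  have hv : ∀ z, z ∉ Set.range φ.toEmbedding →
      (fun z : Λ₂ => if z ∈ rangeSites φ.toEmbedding then siteParity else (1 : Matrix (Fin 4) (Fin 4) ℂ)) z = 1 := by
    intro z hz
    have hz' : z ∉ rangeSites φ.toEmbedding := fun h => hz ((mem_rangeSites_iff _ _).1 h)
    simp only [hz', if_false]
  rw [hfam]
  exact spinEmbed_productOp φ.toEmbedding
    (fun z : Λ₂ => if z ∈ rangeSites φ.toEmbedding then siteParity else (1 : Matrix (Fin 4) (Fin 4) ℂ)) hv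

/-- `P_below` and the block parity `Q` commute (both are products of the commuting site factors `F_z`, `𝟙`).
[cite: EsslerEtAl2005, §12.3.4 eq. (12.198)] -/
theorem productOp_below_mul_blockParity_comm (φ : Λ₁ ↪o Λ₂) :
    productOp (fun z : Λ₂ => if z ∈ rangeSites φ.toEmbedding then (1 : Matrix (Fin 4) (Fin 4) ℂ) else siteParity) *
        productOp (fun z : Λ₂ => if z ∈ rangeSites φ.toEmbedding then siteParity else (1 : Matrix (Fin 4) (Fin 4) ℂ)) =
      productOp (fun z : Λ₂ => if z ∈ rangeSites φ.toEmbedding then siteParity else (1 : Matrix (Fin 4) (Fin 4) ℂ)) *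
        productOp (fun z : Λ₂ => if z ∈ rangeSites φ.toEmbedding then (1 : Matrix (Fin 4) (Fin 4) ℂ) else siteParity) := by
  rw [productOp_mul, productOp_mul]
  congr 1
  funext z
  by_cases hz : z ∈ rangeSites φ.toEmbedding
  · simp only [hz, if_true, mul_one, one_mul]
  · simp only [hz, if_false, mul_one, one_mul]

/-- `Q² = 1` for the block parity (`F² = 1` sitewise). [cite: EsslerEtAl2005, §12.3.4 eq. (12.198)] -/
theorem blockParity_mul_self (φ : Λ₁ ↪o Λ₂) :
    productOp (fun z : Λ₂ => if z ∈ rangeSites φ.toEmbedding then siteParity else (1 : Matrix (Fin 4) (Fin 4) ℂ)) *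
        productOp (fun z : Λ₂ => if z ∈ rangeSites φ.toEmbedding then siteParity else (1 : Matrix (Fin 4) (Fin 4) ℂ)) =
      1 := by
  rw [productOp_mul, ← productOp_one]
  congr 1
  funext z
  by_cases hz : z ∈ rangeSites φ.toEmbedding
  · simp only [hz, if_true, siteParity_mul_siteParity]
  · simp only [hz, if_false, mul_one]

/-- The image of `Θ B` is the conjugate of the image of `B` by the block parity. [cite: ArakiMoriya2003, §4.1 Def. 4.2] -/
theorem spinEmbed_toSpin_parityAut (φ : Λ₁ ↪o Λ₂) (B : Matrix (Finset (Orb Λ₁)) (Finset (Orb Λ₁)) ℂ) :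
    spinEmbed φ.toEmbedding (toSpin (parityAut B)) =
      productOp (fun z : Λ₂ => if z ∈ rangeSites φ.toEmbedding then siteParity else (1 : Matrix (Fin 4) (Fin 4) ℂ)) *
        spinEmbed φ.toEmbedding (toSpin B) *
        productOp (fun z : Λ₂ => if z ∈ rangeSites φ.toEmbedding then siteParity else (1 : Matrix (Fin 4) (Fin 4) ℂ)) := by
  rw [toSpin_parityAut, map_mul, map_mul, spinEmbed_productOp_siteParity]

end UpperSet

end JordanWigner

end Literature.MathematicalPhysics.QuantumLattice
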